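import Summits.ValiantsHypothesis.ValiantsHypothesis.Theses.KPlusLogSqLaw
import Summits.ValiantsHypothesis.ValiantsHypothesis.Theorems.KPlusLogSqLawRegimeCollapse

/-!
# Route «KPlusLogSqLaw», crux `WeakLifting` (stmt-ValiantsHypothesis-19561) next to crux `TropicalB` (stmt-ValiantsHypothesis-19771) —
# given `TropicalB`, every regime stub of the weak-LIFT skeleton (thin, fat, and the plan-only EDGE rung `K = ⌊log₂ m⌋²`)
# is the whole crux

HONEST FRAMING.  Helper file (seat val-sym-trop-p4 (g2), cell `pub-symmetroid`, 2026-08-26) for the two open cruxes of the route after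
its rev-8 edit (`closes (hT : TropicalB) (hW : WeakLifting)`).  IMPLICATIONS / EQUIVALENCES between OPEN statements only — the regime
stubs `stub_weakLiftThin` / `stub_weakLiftFat` / `stub_weakLiftRungEdge` of `Cruxes/WeakLifting/Lines/birth.lean` (stated over the tree row
`TropRootLawAt ≡ TropRowW`), `TropicalB` and its regime stubs, Conjecture B = `KPlusLogSqLaw`, and `WeakLifting` in its row form
`∃ C, ∀ m K n, TropRootLawAt m K n → RealRootLawAt m K (2^(C(K+L²))·(n+1))` (δ-equal to `Theses.KPlusLogSqLaw.WeakLifting`, as in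
`…WeakLiftingBridge`).  Nothing is asserted about any of them, about `MatrixDescartes` (stmt-ValiantsHypothesis-18050) or VP ≠ VNP.
`L = ⌊log₂ m⌋` throughout.

The lead's custody note R1401 (ii) asked whether the padding collapse of `…TropicalBRegimeCollapse` / `…RegimeCollapse` reaches the
weak-LIFT skeleton.  Unconditionally it does not (the tropical row enters each weak-LIFT stub as a hypothesis AT THE SAME FORMAT, so no
padding applies), but GIVEN the other crux `TropicalB` it does, completely:
* `realThin_of_weakLiftThin_of_tropThin`, `realFat_of_weakLiftFat_of_tropFat` — a weak-LIFT regime stub plus the tropical stub of the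
  same regime give Conjecture B on that regime, hence (real-side collapse `kPlusLogSqLaw_of_realThin/_of_realFat`) on ALL formats:
  `kPlusLogSqLaw_of_tropThin_of_weakLiftThin`, `kPlusLogSqLaw_of_tropFat_of_weakLiftFat`;
* `kPlusLogSqLaw_of_tropicalB_of_weakLiftEdge` — even the plan-only EDGE rung (`K = L²` only, slack `2^(C·2L²)`) gives B once
  `TropicalB` holds (through the log-square row `kPlusLogSqLaw_iff_logSqRow`);
* hence, since `B → WeakLifting` outright (`TropicalCensus.weakLifting_of_kPlusLogSqLaw`): `weakLifting_of_tropicalB_of_weakLiftThin`,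
  `weakLifting_of_tropicalB_of_weakLiftFat`, `weakLifting_of_tropicalB_of_weakLiftEdge`, and the equivalences under `TropicalB`:
  `weakLiftThin_iff_kPlusLogSqLaw_of_tropicalB`, `weakLiftFat_iff_kPlusLogSqLaw_of_tropicalB`, `weakLiftEdge_iff_kPlusLogSqLaw_of_tropicalB`.
READING (for custody): in the presence of the route's other item the weak-LIFT skeleton has no informative regime split — thin, fat and the
edge rung are each «B given TB»; the honest registered content of `WeakLifting` is ONE statement, e.g. the edge rung.
[folklore] bookkeeping; the statements themselves are conjectures of the cell (no citation exists).
-/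

set_option linter.dupNamespace false
set_option autoImplicit false

namespace Summit.ValiantsHypothesis.ValiantsHypothesis.Theorems.KPlusLogSqLaw

open Summit.ValiantsHypothesis.ValiantsHypothesis.Theses.KPlusLogSqLaw (TropicalB)
open Summit.ValiantsHypothesis.ValiantsHypothesis.Theorems.LacunarySymmetroidMatrixDescartes (RealRootLawAt KPlusLogSqLaw)
open Summit.ValiantsHypothesis.ValiantsHypothesis.Theorems.LacunarySymmetroidMatrixDescartes.Census (realRootLawAt_mono)
open Summit.ValiantsHypothesis.ValiantsHypothesis.Theorems.LacunarySymmetroidMatrixDescartes.TropicalCensus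
  (TropRootLawAt realRootLawAt_zero weakLifting_of_kPlusLogSqLaw)

/-- `2^a · (2^b + 1) ≤ 2^(a + b + 1)`. [folklore] -/
theorem two_pow_mul_two_pow_succ_le (a b : ℕ) : 2 ^ a * (2 ^ b + 1) ≤ 2 ^ (a + b + 1) := by
  have e1 : 2 ^ b + 1 ≤ 2 ^ (b + 1) := Nat.pow_lt_pow_right (by norm_num) (Nat.lt_succ_self _)
  calc 2 ^ a * (2 ^ b + 1) ≤ 2 ^ a * 2 ^ (b + 1) := Nat.mul_le_mul_left _ e1
    _ = 2 ^ (a + b + 1) := by rw [← pow_add, Nat.add_assoc]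

/-! ## 1. A weak-LIFT regime stub plus the tropical stub of the same regime give Conjecture B -/

/-- **`WeakLiftThin → TropThin → RealThin`** (`C = 2C_W + C_T + 1`: on thin formats `K + L² ≤ 2L²`). [folklore] -/
theorem realThin_of_weakLiftThin_of_tropThin
    (hW : ∃ C : ℕ, ∀ m K n : ℕ, K ≤ Nat.log 2 m ^ 2 → TropRootLawAt m K n →
      RealRootLawAt m K (2 ^ (C * (K + Nat.log 2 m ^ 2)) * (n + 1)))
    (hT : ∃ C : ℕ, ∀ m K : ℕ, K ≤ Nat.log 2 m ^ 2 → TropRootLawAt m K (2 ^ (C * Nat.log 2 m ^ 2))) :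
    ∃ C : ℕ, ∀ m K : ℕ, K ≤ Nat.log 2 m ^ 2 → RealRootLawAt m K (2 ^ (C * Nat.log 2 m ^ 2)) := by
  obtain ⟨CW, hW⟩ := hW
  obtain ⟨CT, hT⟩ := hT
  refine ⟨2 * CW + CT + 1, fun m K hK => ?_⟩
  rcases Nat.eq_zero_or_pos K with rfl | hK0
  · exact realRootLawAt_zero m _
  have h1 := hW m K _ hK (hT m K hK)
  refine realRootLawAt_mono ((two_pow_mul_two_pow_succ_le _ _).trans (Nat.pow_le_pow_right two_pos ?_)) h1
  have e2 : CW * (K + Nat.log 2 m ^ 2) ≤ CW * (2 * Nat.log 2 m ^ 2) := Nat.mul_le_mul_left CW (by omega)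
  nlinarith

/-- **`WeakLiftFat → TropFat → RealFat`** (`C = 2C_W + C_T + 1`: on fat formats `K + L² ≤ 2K`). [folklore] -/
theorem realFat_of_weakLiftFat_of_tropFat
    (hW : ∃ C : ℕ, ∀ m K n : ℕ, Nat.log 2 m ^ 2 ≤ K → TropRootLawAt m K n →
      RealRootLawAt m K (2 ^ (C * (K + Nat.log 2 m ^ 2)) * (n + 1)))
    (hT : ∃ C : ℕ, ∀ m K : ℕ, Nat.log 2 m ^ 2 ≤ K → TropRootLawAt m K (2 ^ (C * K))) :
    ∃ C : ℕ, ∀ m K : ℕ, Nat.log 2 m ^ 2 ≤ K → RealRootLawAt m K (2 ^ (C * K)) := by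
  obtain ⟨CW, hW⟩ := hW
  obtain ⟨CT, hT⟩ := hT
  refine ⟨2 * CW + CT + 1, fun m K hK => ?_⟩
  rcases Nat.eq_zero_or_pos K with rfl | hK0
  · exact realRootLawAt_zero m _
  have h1 := hW m K _ hK (hT m K hK)
  refine realRootLawAt_mono ((two_pow_mul_two_pow_succ_le _ _).trans (Nat.pow_le_pow_right two_pos ?_)) h1
  have e2 : CW * (K + Nat.log 2 m ^ 2) ≤ CW * (2 * K) := Nat.mul_le_mul_left CW (by omega)
  nlinarith

/-- **`TropThin → WeakLiftThin → B`** (the thin pair of the rev-8 route closes Conjecture B on all formats). -/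
theorem kPlusLogSqLaw_of_tropThin_of_weakLiftThin
    (hT : ∃ C : ℕ, ∀ m K : ℕ, K ≤ Nat.log 2 m ^ 2 → TropRootLawAt m K (2 ^ (C * Nat.log 2 m ^ 2)))
    (hW : ∃ C : ℕ, ∀ m K n : ℕ, K ≤ Nat.log 2 m ^ 2 → TropRootLawAt m K n →
      RealRootLawAt m K (2 ^ (C * (K + Nat.log 2 m ^ 2)) * (n + 1))) :
    KPlusLogSqLaw :=
  kPlusLogSqLaw_of_realThin (realThin_of_weakLiftThin_of_tropThin hW hT)

/-- **`TropFat → WeakLiftFat → B`** (the fat pair of the rev-8 route closes Conjecture B on all formats). -/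
theorem kPlusLogSqLaw_of_tropFat_of_weakLiftFat
    (hT : ∃ C : ℕ, ∀ m K : ℕ, Nat.log 2 m ^ 2 ≤ K → TropRootLawAt m K (2 ^ (C * K)))
    (hW : ∃ C : ℕ, ∀ m K n : ℕ, Nat.log 2 m ^ 2 ≤ K → TropRootLawAt m K n →
      RealRootLawAt m K (2 ^ (C * (K + Nat.log 2 m ^ 2)) * (n + 1))) :
    KPlusLogSqLaw :=
  kPlusLogSqLaw_of_realFat (realFat_of_weakLiftFat_of_tropFat hW hT)

/-- **`TropicalB → WeakLiftEdge → B`**: even the plan-only EDGE rung of the weak-LIFT skeleton (`stub_weakLiftRungEdge`, the single row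
`K = ⌊log₂ m⌋²` with slack `2^(C·2L²)`) gives Conjecture B once `TropicalB` holds — through the log-square row (`kPlusLogSqLaw_iff_logSqRow`). -/
theorem kPlusLogSqLaw_of_tropicalB_of_weakLiftEdge (hTB : TropicalB)
    (hE : ∃ C : ℕ, ∀ m n : ℕ, TropRootLawAt m (Nat.log 2 m ^ 2) n →
      RealRootLawAt m (Nat.log 2 m ^ 2) (2 ^ (C * (2 * Nat.log 2 m ^ 2)) * (n + 1))) :
    KPlusLogSqLaw := by
  obtain ⟨CT, hT⟩ := tropicalB_iff_logSqRow.mp hTB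
  obtain ⟨CE, hE⟩ := hE
  refine kPlusLogSqLaw_iff_logSqRow.mpr ⟨2 * CE + CT + 1, fun m => ?_⟩
  rcases Nat.eq_zero_or_pos (Nat.log 2 m ^ 2) with hL | hL
  · rw [hL]; exact realRootLawAt_zero m _
  have h1 := hE m _ (hT m)
  refine realRootLawAt_mono ((two_pow_mul_two_pow_succ_le _ _).trans (Nat.pow_le_pow_right two_pos ?_)) h1
  nlinarith

/-! ## 2. Hence, given `TropicalB`, every weak-LIFT stub is `WeakLifting` (and Conjecture B) -/

/-- **`TropicalB → WeakLiftThin → WeakLifting`**. -/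
theorem weakLifting_of_tropicalB_of_weakLiftThin (hTB : TropicalB)
    (hW : ∃ C : ℕ, ∀ m K n : ℕ, K ≤ Nat.log 2 m ^ 2 → TropRootLawAt m K n →
      RealRootLawAt m K (2 ^ (C * (K + Nat.log 2 m ^ 2)) * (n + 1))) :
    ∃ C : ℕ, ∀ m K n : ℕ, TropRootLawAt m K n → RealRootLawAt m K (2 ^ (C * (K + Nat.log 2 m ^ 2)) * (n + 1)) :=
  weakLifting_of_kPlusLogSqLaw (kPlusLogSqLaw_of_tropThin_of_weakLiftThin (thinStub_of_tropicalB hTB) hW)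

/-- **`TropicalB → WeakLiftFat → WeakLifting`**. -/
theorem weakLifting_of_tropicalB_of_weakLiftFat (hTB : TropicalB)
    (hW : ∃ C : ℕ, ∀ m K n : ℕ, Nat.log 2 m ^ 2 ≤ K → TropRootLawAt m K n →
      RealRootLawAt m K (2 ^ (C * (K + Nat.log 2 m ^ 2)) * (n + 1))) :
    ∃ C : ℕ, ∀ m K n : ℕ, TropRootLawAt m K n → RealRootLawAt m K (2 ^ (C * (K + Nat.log 2 m ^ 2)) * (n + 1)) :=
  weakLifting_of_kPlusLogSqLaw (kPlusLogSqLaw_of_tropFat_of_weakLiftFat (fatStub_of_tropicalB hTB) hW)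

/-- **`TropicalB → WeakLiftEdge → WeakLifting`**: given the other crux, the edge rung alone is the whole weak-LIFT crux. -/
theorem weakLifting_of_tropicalB_of_weakLiftEdge (hTB : TropicalB)
    (hE : ∃ C : ℕ, ∀ m n : ℕ, TropRootLawAt m (Nat.log 2 m ^ 2) n →
      RealRootLawAt m (Nat.log 2 m ^ 2) (2 ^ (C * (2 * Nat.log 2 m ^ 2)) * (n + 1))) :
    ∃ C : ℕ, ∀ m K n : ℕ, TropRootLawAt m K n → RealRootLawAt m K (2 ^ (C * (K + Nat.log 2 m ^ 2)) * (n + 1)) :=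
  weakLifting_of_kPlusLogSqLaw (kPlusLogSqLaw_of_tropicalB_of_weakLiftEdge hTB hE)

/-- `B → WeakLiftThin` (idle tropical hypothesis). [folklore] -/
theorem weakLiftThin_of_kPlusLogSqLaw (h : KPlusLogSqLaw) :
    ∃ C : ℕ, ∀ m K n : ℕ, K ≤ Nat.log 2 m ^ 2 → TropRootLawAt m K n →
      RealRootLawAt m K (2 ^ (C * (K + Nat.log 2 m ^ 2)) * (n + 1)) := by
  obtain ⟨C, hC⟩ := weakLifting_of_kPlusLogSqLaw h
  exact ⟨C, fun m K n _ hrow => hC m K n hrow⟩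

/-- `B → WeakLiftFat` (idle tropical hypothesis). [folklore] -/
theorem weakLiftFat_of_kPlusLogSqLaw (h : KPlusLogSqLaw) :
    ∃ C : ℕ, ∀ m K n : ℕ, Nat.log 2 m ^ 2 ≤ K → TropRootLawAt m K n →
      RealRootLawAt m K (2 ^ (C * (K + Nat.log 2 m ^ 2)) * (n + 1)) := by
  obtain ⟨C, hC⟩ := weakLifting_of_kPlusLogSqLaw h
  exact ⟨C, fun m K n _ hrow => hC m K n hrow⟩

/-- `B → WeakLiftEdge` (idle tropical hypothesis; `K + L² = 2L²` on the edge). [folklore] -/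
theorem weakLiftEdge_of_kPlusLogSqLaw (h : KPlusLogSqLaw) :
    ∃ C : ℕ, ∀ m n : ℕ, TropRootLawAt m (Nat.log 2 m ^ 2) n →
      RealRootLawAt m (Nat.log 2 m ^ 2) (2 ^ (C * (2 * Nat.log 2 m ^ 2)) * (n + 1)) := by
  obtain ⟨C, hC⟩ := weakLifting_of_kPlusLogSqLaw h
  refine ⟨C, fun m n hrow => ?_⟩
  have h1 := hC m (Nat.log 2 m ^ 2) n hrow
  rwa [← two_mul] at h1

/-- **Given `TropicalB`: `WeakLiftThin ↔ B`.** -/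
theorem weakLiftThin_iff_kPlusLogSqLaw_of_tropicalB (hTB : TropicalB) :
    (∃ C : ℕ, ∀ m K n : ℕ, K ≤ Nat.log 2 m ^ 2 → TropRootLawAt m K n →
      RealRootLawAt m K (2 ^ (C * (K + Nat.log 2 m ^ 2)) * (n + 1))) ↔ KPlusLogSqLaw :=
  ⟨fun hW => kPlusLogSqLaw_of_tropThin_of_weakLiftThin (thinStub_of_tropicalB hTB) hW, weakLiftThin_of_kPlusLogSqLaw⟩

/-- **Given `TropicalB`: `WeakLiftFat ↔ B`.** -/
theorem weakLiftFat_iff_kPlusLogSqLaw_of_tropicalB (hTB : TropicalB) :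
    (∃ C : ℕ, ∀ m K n : ℕ, Nat.log 2 m ^ 2 ≤ K → TropRootLawAt m K n →
      RealRootLawAt m K (2 ^ (C * (K + Nat.log 2 m ^ 2)) * (n + 1))) ↔ KPlusLogSqLaw :=
  ⟨fun hW => kPlusLogSqLaw_of_tropFat_of_weakLiftFat (fatStub_of_tropicalB hTB) hW, weakLiftFat_of_kPlusLogSqLaw⟩

/-- **Given `TropicalB`: `WeakLiftEdge ↔ B`** — thin, fat and edge stubs of the weak-LIFT skeleton are one statement given the other crux. -/
theorem weakLiftEdge_iff_kPlusLogSqLaw_of_tropicalB (hTB : TropicalB) :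
    (∃ C : ℕ, ∀ m n : ℕ, TropRootLawAt m (Nat.log 2 m ^ 2) n →
      RealRootLawAt m (Nat.log 2 m ^ 2) (2 ^ (C * (2 * Nat.log 2 m ^ 2)) * (n + 1))) ↔ KPlusLogSqLaw :=
  ⟨kPlusLogSqLaw_of_tropicalB_of_weakLiftEdge hTB, weakLiftEdge_of_kPlusLogSqLaw⟩

end Summit.ValiantsHypothesis.ValiantsHypothesis.Theorems.KPlusLogSqLaw
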